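import Literature.ModelTheory.ExponentialFields.DefinablyCompleteRolleCount
import HarnessLib

/-!
# Zeros of one-variable exponential polynomials in definably complete ordered exponential fields

Topic `Literature/ModelTheory/ExponentialFields`.  Let `K` be an ordered field with an ordered
exponential `E` (`E(x + y) = E(x)E(y)`, `x + 1 ≤ E(x)`, whence `E' = E`) carrying a definably
complete structure in which `<`, `+`, `·` and the graph of `E` are definable — e.g. any model of
the recursive subtheory `OEF ∪ [DC]` of `Th(ℝ_exp)` (`DefinableCompletenessCodes.lean`).  A
*one-variable exponential polynomial* over `K` is `F(x) = Σ_{j<n} P_j(x) E(x)^j` with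
`P_j ∈ K[X]` (`UnaryExpPoly.eval`).  **Theorem** (`IsOrderedExp.finite_setOf_unaryExpPoly_eq_zero`):
if some `P_j ≠ 0`, then `F` has finitely many zeros in `K`, at most
`Σ_{P_j ≠ 0} (deg P_j + 1) - 1` (`UnaryExpPoly.budget`).

This is the one-variable case (`n = 1`, Pfaffian chain `(exp)`) of Khovanskii's bound on the
regular zeros of Pfaffian maps *over definably complete fields* (A. Fornasiero, T. Servi,
*Definably complete Baire structures*, Fund. Math. 209 (2010), Theorem 8.4 (1), §8.2; for `ℝ`:
A. G. Khovanskii, *Fewnomials* (1991), Ch. III, and the classical Laguerre–Pólya count of real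
zeros of `Σ p_j(x) e^{λ_j x}`), obtained by the Rolle count of
`DefinablyCompleteRolleCount.lean`: multiplying `F` by `E(-x)^{j₀}`, `j₀` the least exponent
present, does not change the zeros, and the derivative of `F(x)E(-x)^{j₀}` is `G(x)E(-x)^{j₀}`
with `G = Σ_j (P_j' + (j - j₀)P_j) E^j` an exponential polynomial of smaller budget
(`UnaryExpPoly.budget_derivFamily_lt`): the `j₀`-th coefficient loses a degree, the others keep
theirs (`char K = 0`).  When `G = 0`, `F = c·E^{j₀}` has no zeros.  Such uniform finiteness
statements, provable in `OEF ∪ [DC]`, are the raw material of the o-minimality of its models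
(Fornasiero–Servi 2010, Theorem 8.2) on the Fornasiero–Servi / Berarducci–Servi route to
Macintyre–Wilkie's theorem.

Everything is proved; the only definitions are the bookkeeping `UnaryExpPoly.eval`,
`UnaryExpPoly.budget`, `UnaryExpPoly.derivFamily`.

## References

* A. Fornasiero, T. Servi, *Definably complete Baire structures*, Fund. Math. 209 (2010),
  Theorem 8.4, §8.2. [FornasieroServi2010]
* A. G. Khovanskii, *Fewnomials*, Transl. Math. Monogr. 88, AMS (1991), Ch. III.
  [Khovanskii1991]
-/

noncomputable section

open Set FirstOrder FirstOrder.Language Polynomial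
open _root_.Filter _root_.Topology

namespace Literature.ModelTheory.ExponentialFields

universe u v

/-! ### More derivative algebra: reflection `y ↦ -y` -/

section Deriv

variable {K : Type*} [Field K] [TopologicalSpace K] [IsTopologicalRing K]

/-- Chain rule with the reflection: `(f(-y))' = -f'(-x)`. [folklore] -/
theorem HasFieldDerivAt.comp_neg {f : K → K} {f' x : K} (hf : HasFieldDerivAt f f' (-x)) :
    HasFieldDerivAt (fun y => f (-y)) (-f') x := by
  rw [hasFieldDerivAt_iff] at hf ⊢
  have hneg : Tendsto (fun y : K => -y) (𝓝[≠] x) (𝓝[≠] (-x)) := by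
    refine tendsto_nhdsWithin_of_tendsto_nhds_of_eventually_within _ ?_ ?_
    · exact (continuous_neg.tendsto x).mono_left nhdsWithin_le_nhds
    · exact eventually_nhdsWithin_of_forall fun y hy h => hy (neg_injective h)
  have h := (hf.comp hneg).neg
  refine h.congr' (eventually_nhdsWithin_of_forall fun y _ => ?_)
  show -((f (-y) - f (-x)) / (-y - -x)) = (f (-y) - f (-x)) / (y - x)
  rw [show -y - -x = -(y - x) by ring, div_neg, neg_neg]

end Deriv

/-! ### One-variable exponential polynomials: bookkeeping -/

namespace UnaryExpPoly

section Algebra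

variable {K : Type*} [Field K]

/-- **Evaluation of the one-variable exponential polynomial** `Σ_{j<n} P_j(x) E(x)^j` with
coefficient polynomials `P_j ∈ K[X]` at `x`, for a map `E : K → K`. [folklore] -/
def eval (E : K → K) (P : ℕ → K[X]) (n : ℕ) (x : K) : K :=
  ∑ j ∈ Finset.range n, (P j).eval x * E x ^ j

/-- The Rolle budget of one coefficient: `deg p + 1`, and `0` for `p = 0` (read off the
`WithBot ℕ`-valued degree, so that no decidability of equality in `K` is needed). [folklore] -/
def termBudget (p : K[X]) : ℕ :=
  if p.degree = ⊥ then 0 else p.natDegree + 1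

/-- **The Rolle budget** `Σ_{j<n, P_j ≠ 0} (deg P_j + 1)` of an exponential polynomial: one more
than the bound on its number of zeros. [folklore] -/
def budget (P : ℕ → K[X]) (n : ℕ) : ℕ :=
  ∑ j ∈ Finset.range n, termBudget (P j)

/-- The zero polynomial has budget `0`. [folklore] -/
@[simp] theorem termBudget_zero : termBudget (0 : K[X]) = 0 := by
  simp [termBudget]

/-- A nonzero polynomial has budget `deg p + 1`. [folklore] -/
theorem termBudget_of_ne_zero {p : K[X]} (hp : p ≠ 0) : termBudget p = p.natDegree + 1 := by
  simp [termBudget, Polynomial.degree_eq_bot, hp]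

/-- In all cases the budget is at most `deg p + 1`. [folklore] -/
theorem termBudget_le (p : K[X]) : termBudget p ≤ p.natDegree + 1 := by
  unfold termBudget
  split_ifs <;> omega

/-- The coefficient family of the derivative of `Σ_j P_j(x) E(x)^j · E(-x)^s`, namely
`P_j' + (j - s) P_j`. [folklore] -/
def derivFamily (s : K) (P : ℕ → K[X]) (j : ℕ) : K[X] :=
  (P j).derivative + C ((j : K) - s) * P j

/-- No terms. [folklore] -/
theorem eval_range_zero (E : K → K) (P : ℕ → K[X]) (x : K) : eval E P 0 x = 0 := by
  simp [eval]

/-- One more term. [folklore] -/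
theorem eval_range_succ (E : K → K) (P : ℕ → K[X]) (n : ℕ) (x : K) :
    eval E P (n + 1) x = eval E P n x + (P n).eval x * E x ^ n := by
  simp [eval, Finset.sum_range_succ]

/-- `eval` in the shifted derivative family: `Σ (P_j' + (j - s)P_j) E^j = Σ (P_j' + j P_j) E^j - s Σ P_j E^j`.
[folklore] -/
theorem eval_derivFamily (E : K → K) (s : K) (P : ℕ → K[X]) (n : ℕ) (x : K) :
    eval E (derivFamily s P) n x = eval E (derivFamily 0 P) n x - s * eval E P n x := by
  simp only [eval, derivFamily, Finset.mul_sum, ← Finset.sum_sub_distrib]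
  refine Finset.sum_congr rfl fun j _ => ?_
  simp only [Polynomial.eval_add, Polynomial.eval_mul, Polynomial.eval_C, sub_zero]
  ring

/-- If only `P_{j₀}` is present, `eval` is the single term. [folklore] -/
theorem eval_eq_single (E : K → K) {P : ℕ → K[X]} {n j₀ : ℕ} (hj₀ : j₀ < n)
    (h : ∀ j < n, j ≠ j₀ → P j = 0) (x : K) :
    eval E P n x = (P j₀).eval x * E x ^ j₀ := by
  unfold eval
  rw [Finset.sum_eq_single j₀]
  · intro j hj hne
    rw [h j (Finset.mem_range.1 hj) hne, Polynomial.eval_zero, zero_mul]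
  · intro hj
    exact absurd (Finset.mem_range.2 hj₀) hj

/-- `P_j' + c P_j = 0` with `c ≠ 0` forces `P_j = 0` (compare top coefficients). [folklore] -/
theorem eq_zero_of_derivative_add_C_mul {p : K[X]} {c : K} (hc : c ≠ 0)
    (h : p.derivative + C c * p = 0) : p = 0 := by
  by_contra hp
  have hcoeff := congrArg (fun q : K[X] => q.coeff p.natDegree) h
  simp only [Polynomial.coeff_add, Polynomial.coeff_derivative, Polynomial.coeff_C_mul,
    Polynomial.coeff_zero, Polynomial.coeff_natDegree_succ_eq_zero, zero_mul, zero_add] at hcoeff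
  exact (mul_ne_zero hc (Polynomial.leadingCoeff_ne_zero.2 hp)) hcoeff

/-- In characteristic zero, `p' = 0` forces `deg p = 0`. [folklore] -/
theorem natDegree_eq_zero_of_derivative_eq_zero' [CharZero K] {p : K[X]}
    (h : p.derivative = 0) : p.natDegree = 0 := by
  by_contra hd0
  obtain ⟨d, hd⟩ := Nat.exists_eq_succ_of_ne_zero hd0
  have hd' : p.natDegree = d + 1 := hd
  have hcoeff := congrArg (fun q : K[X] => q.coeff d) h
  simp only [Polynomial.coeff_derivative, Polynomial.coeff_zero] at hcoeff
  have hlead : p.coeff (d + 1) ≠ 0 := by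
    rw [← hd']
    exact Polynomial.leadingCoeff_ne_zero.2 fun hp => by simp [hp] at hd'
  have hd1 : ((d : K) + 1) ≠ 0 := by exact_mod_cast Nat.succ_ne_zero d
  exact (mul_ne_zero hlead hd1) hcoeff

/-- `deg (P_j' + c P_j) ≤ deg P_j`. [folklore] -/
theorem natDegree_derivFamily_le (s : K) (P : ℕ → K[X]) (j : ℕ) :
    (derivFamily s P j).natDegree ≤ (P j).natDegree := by
  unfold derivFamily
  refine (Polynomial.natDegree_add_le _ _).trans (max_le ?_ ?_)
  · exact (Polynomial.natDegree_derivative_le _).trans (Nat.sub_le _ _)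
  · exact Polynomial.natDegree_C_mul_le _ _

/-- A vanishing coefficient gives a vanishing derived coefficient. [folklore] -/
theorem derivFamily_eq_zero_of_eq_zero (s : K) {P : ℕ → K[X]} {j : ℕ} (h : P j = 0) :
    derivFamily s P j = 0 := by
  simp [derivFamily, h]

/-- At the pivot exponent `j₀` the derived coefficient is the plain derivative. [folklore] -/
theorem derivFamily_self (P : ℕ → K[X]) (j₀ : ℕ) :
    derivFamily (j₀ : K) P j₀ = (P j₀).derivative := by
  simp [derivFamily]

/-- The budget is positive as soon as some coefficient is present. [folklore] -/
theorem budget_pos {P : ℕ → K[X]} {n j : ℕ} (hj : j < n) (hP : P j ≠ 0) : 0 < budget P n := by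
  unfold budget
  have hle := Finset.single_le_sum (s := Finset.range n) (f := fun j => termBudget (P j))
    (fun _ _ => Nat.zero_le _) (Finset.mem_range.2 hj)
  have h1 : 0 < termBudget (P j) := by rw [termBudget_of_ne_zero hP]; exact Nat.succ_pos _
  exact lt_of_lt_of_le h1 hle

/-- Derivation does not increase the budget of a coefficient. [folklore] -/
theorem termBudget_derivFamily_le (s : K) (P : ℕ → K[X]) (j : ℕ) :
    termBudget (derivFamily s P j) ≤ termBudget (P j) := by
  by_cases hP : P j = 0
  · rw [derivFamily_eq_zero_of_eq_zero s hP, hP]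
  · rw [termBudget_of_ne_zero hP]
    exact (termBudget_le _).trans (Nat.succ_le_succ (natDegree_derivFamily_le s P j))

/-- At the pivot the budget of the coefficient drops. [folklore] -/
theorem termBudget_derivative_lt {p : K[X]} (hp : p ≠ 0) :
    termBudget p.derivative + 1 ≤ termBudget p := by
  rw [termBudget_of_ne_zero hp]
  by_cases hd : p.derivative = 0
  · rw [hd, termBudget_zero]
    omega
  · rw [termBudget_of_ne_zero hd]
    have h1 := Polynomial.natDegree_derivative_le p
    have h2 : p.natDegree ≠ 0 := fun h0 => hd (Polynomial.derivative_of_natDegree_zero h0)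
    omega

/-- **The budget drops under derivation at the least exponent present**: if `P_{j₀} ≠ 0`
(`j₀ < n`), then `budget (P_j' + (j - j₀)P_j) + 1 ≤ budget P` — the pivot coefficient loses a
degree (or disappears), the others do not grow. [folklore] -/
theorem budget_derivFamily_lt {P : ℕ → K[X]} {n j₀ : ℕ} (hj₀ : j₀ < n) (hP : P j₀ ≠ 0) :
    budget (derivFamily (j₀ : K) P) n + 1 ≤ budget P n := by
  unfold budget
  have hmem : j₀ ∈ Finset.range n := Finset.mem_range.2 hj₀
  rw [← Finset.add_sum_erase _ _ hmem, ← Finset.add_sum_erase _ (fun j => termBudget (P j)) hmem]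
  have hrest : ∑ j ∈ (Finset.range n).erase j₀, termBudget (derivFamily (j₀ : K) P j) ≤
      ∑ j ∈ (Finset.range n).erase j₀, termBudget (P j) :=
    Finset.sum_le_sum fun j _ => termBudget_derivFamily_le _ P j
  have hpivot : termBudget (derivFamily (j₀ : K) P j₀) + 1 ≤ termBudget (P j₀) := by
    rw [derivFamily_self]
    exact termBudget_derivative_lt hP
  omega

end Algebra

/-! ### Definability of the graph -/

section Definable

variable {K : Type*} [Field K] {L : FirstOrder.Language.{u, v}} [L.Structure K]

/-- Powers of a definable function of tuples are definable (graph of `·` definable). [folklore] -/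
theorem definableFun_pow {α : Type*}
    (hmul : (univ : Set K).Definable L {v : Fin 3 → K | v 2 = v 0 * v 1})
    {g : (α → K) → K} (hg : (univ : Set K).DefinableFun L g) (m : ℕ) :
    (univ : Set K).DefinableFun L (fun v => g v ^ m) := by
  induction m with
  | zero => simpa using definableFun_const_params (L := L) α (mem_univ (1 : K))
  | succ m ih =>
    simp only [pow_succ]
    exact definableFun_apply₂_params hmul ih hg

/-- `v ↦ Σ_{j<n} P_j(g v) E(g v)^j` is a definable function of tuples. [folklore] -/
theorem definableFun_eval {α : Type*} {E : K → K}
    (hadd : (univ : Set K).Definable L {v : Fin 3 → K | v 2 = v 0 + v 1})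
    (hmul : (univ : Set K).Definable L {v : Fin 3 → K | v 2 = v 0 * v 1})
    (hE : (univ : Set K).Definable L {v : Fin 2 → K | v 1 = E (v 0)})
    (P : ℕ → K[X]) (n : ℕ) {g : (α → K) → K} (hg : (univ : Set K).DefinableFun L g) :
    (univ : Set K).DefinableFun L (fun v => eval E P n (g v)) := by
  induction n with
  | zero =>
    simp only [eval_range_zero]
    exact definableFun_const_params (L := L) α (mem_univ (0 : K))
  | succ n ih =>
    simp only [eval_range_succ]
    refine definableFun_apply₂_params hadd ih ?_
    exact definableFun_apply₂_params hmul (definableFun_polynomial_eval hadd hmul (P n) hg)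
      (definableFun_pow hmul (definableFun_apply_params hE hg) n)

/-- The graph of `x ↦ (Σ_j P_j(x) E(x)^j) · E(-x)^m` is definable. [folklore] -/
theorem definable_graph_eval_mul {E : K → K}
    (hadd : (univ : Set K).Definable L {v : Fin 3 → K | v 2 = v 0 + v 1})
    (hmul : (univ : Set K).Definable L {v : Fin 3 → K | v 2 = v 0 * v 1})
    (hE : (univ : Set K).Definable L {v : Fin 2 → K | v 1 = E (v 0)})
    (P : ℕ → K[X]) (n m : ℕ) :
    (univ : Set K).Definable L
      {v : Fin 2 → K | v 1 = eval E P n (v 0) * E (-(v 0)) ^ m} := by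
  have hneg : (univ : Set K).DefinableFun L (fun v : Fin 2 → K => (0 : K) - v 0) :=
    definableFun_apply₂_params (definable_sub_of_add hadd)
      (definableFun_const_params (L := L) _ (mem_univ (0 : K))) (definableFun_proj_params 0)
  have hEneg : (univ : Set K).DefinableFun L (fun v : Fin 2 → K => E (-(v 0))) := by
    have := definableFun_apply_params hE hneg
    simpa only [zero_sub] using this
  have h : (univ : Set K).DefinableFun L
      (fun v : Fin 2 → K => eval E P n (v 0) * E (-(v 0)) ^ m) :=
    definableFun_apply₂_params hmul (definableFun_eval hadd hmul hE P n (definableFun_proj_params 0))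
      (definableFun_pow hmul hEneg m)
  exact definable_graph_of_definableFun (g := fun y => eval E P n y * E (-y) ^ m) h

end Definable

end UnaryExpPoly

/-! ### The derivative of `F(x) E(-x)^m` -/

section OrderedExp

variable {K : Type*} [Field K] [LinearOrder K] [IsStrictOrderedRing K] [TopologicalSpace K]
  [OrderTopology K] {E : K → K}

namespace IsOrderedExp

variable (hE : IsOrderedExp E)
include hE

/-- `(E(-y)^m)' = -m E(-x)^m`. [folklore] -/
theorem hasFieldDerivAt_map_neg_pow (m : ℕ) (x : K) :
    HasFieldDerivAt (fun y => E (-y) ^ m) (-(m : K) * E (-x) ^ m) x := by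
  have h := ((hE.hasFieldDerivAt (-x)).comp_neg).pow m
  convert h using 1
  rcases m with _ | m
  · simp
  · rw [Nat.add_sub_cancel, pow_succ]
    ring

/-- **Termwise differentiation of an exponential polynomial**:
`(Σ_j P_j E^j)' = Σ_j (P_j' + j P_j) E^j` (as `E' = E`). [folklore] -/
theorem hasFieldDerivAt_unaryExpPoly (P : ℕ → K[X]) (n : ℕ) (x : K) :
    HasFieldDerivAt (fun y => UnaryExpPoly.eval E P n y)
      (UnaryExpPoly.eval E (UnaryExpPoly.derivFamily 0 P) n x) x := by
  induction n with
  | zero =>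
    simp only [UnaryExpPoly.eval_range_zero]
    exact hasFieldDerivAt_const 0 x
  | succ n ih =>
    simp only [UnaryExpPoly.eval_range_succ]
    have hterm := (hasFieldDerivAt_polynomial_eval (P n) x).mul ((hE.hasFieldDerivAt x).pow n)
    have h := ih.add hterm
    convert h using 2
    simp only [UnaryExpPoly.derivFamily, eval_add, eval_mul, eval_C, sub_zero]
    rcases n with _ | n
    · simp
    · rw [Nat.add_sub_cancel, pow_succ]
      push_cast
      ring

/-- **The derivative of `F(x) E(-x)^m`** for `F = Σ_j P_j E^j` is `G(x) E(-x)^m` with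
`G = Σ_j (P_j' + (j - m) P_j) E^j`. [folklore] -/
theorem hasFieldDerivAt_unaryExpPoly_mul (P : ℕ → K[X]) (n m : ℕ) (x : K) :
    HasFieldDerivAt (fun y => UnaryExpPoly.eval E P n y * E (-y) ^ m)
      (UnaryExpPoly.eval E (UnaryExpPoly.derivFamily (m : K) P) n x * E (-x) ^ m) x := by
  have h := (hE.hasFieldDerivAt_unaryExpPoly P n x).mul (hE.hasFieldDerivAt_map_neg_pow m x)
  convert h using 1
  rw [UnaryExpPoly.eval_derivFamily E (m : K) P n x]
  ring

/-! ### Finiteness of the zero set -/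

variable {L : FirstOrder.Language.{u, v}} [L.Structure K]

omit [TopologicalSpace K] [OrderTopology K] [L.Structure K] in
/-- Multiplying by `E(-x)^m` does not change the zeros. [folklore] -/
theorem setOf_unaryExpPoly_mul_eq_zero (P : ℕ → K[X]) (n m : ℕ) :
    {x | UnaryExpPoly.eval E P n x * E (-x) ^ m = 0} = {x | UnaryExpPoly.eval E P n x = 0} := by
  ext x
  simp only [mem_setOf_eq, mul_eq_zero, or_iff_left_iff_imp]
  intro h
  exact absurd h (pow_ne_zero _ (hE.pos _).ne')

/-- **A nonzero one-variable exponential polynomial has finitely many zeros, fewer than its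
budget**: in an ordered field with an ordered exponential `E` and a definably complete structure
in which `<`, `+`, `·` and the graph of `E` are definable, if `P_j ≠ 0` for some `j < n` then
`{x | Σ_{j<n} P_j(x) E(x)^j = 0}` is finite of size at most `Σ_{P_j ≠ 0} (deg P_j + 1) - 1` —
Khovanskii's bound for `n = 1` and the chain `(exp)` over definably complete fields
(Fornasiero–Servi 2010, Theorem 8.4 (1); Khovanskii 1991, Ch. III), by induction on the
budget: multiply by `E(-x)^{j₀}` (`j₀` the least exponent present), differentiate
(`hasFieldDerivAt_unaryExpPoly_mul`, `UnaryExpPoly.budget_derivFamily_lt`) and count with Rolle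
(`IsDefinablyComplete.finite_setOf_eq_zero_of_deriv`). [cite: FornasieroServi2010, Theorem 8.4] -/
theorem finite_setOf_unaryExpPoly_eq_zero (hDC : L.IsDefinablyComplete K)
    (hlt : (univ : Set K).Definable L {v : Fin 2 → K | v 0 < v 1})
    (hadd : (univ : Set K).Definable L {v : Fin 3 → K | v 2 = v 0 + v 1})
    (hmul : (univ : Set K).Definable L {v : Fin 3 → K | v 2 = v 0 * v 1})
    (hEdef : (univ : Set K).Definable L {v : Fin 2 → K | v 1 = E (v 0)})
    (P : ℕ → K[X]) (n : ℕ) (hP : ∃ j < n, P j ≠ 0) :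
    {x | UnaryExpPoly.eval E P n x = 0}.Finite ∧
      {x | UnaryExpPoly.eval E P n x = 0}.ncard ≤ UnaryExpPoly.budget P n - 1 := by
  -- strong induction on the budget
  suffices h : ∀ (b : ℕ) (Q : ℕ → K[X]), UnaryExpPoly.budget Q n = b → (∃ j < n, Q j ≠ 0) →
      {x | UnaryExpPoly.eval E Q n x = 0}.Finite ∧
        {x | UnaryExpPoly.eval E Q n x = 0}.ncard ≤ b - 1 from
    h _ P rfl hP
  intro b
  induction b using Nat.strong_induction_on with
  | _ b ih =>
  intro Q hb hQ
  classical
  -- the least exponent present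
  have hex : ∃ j, j < n ∧ Q j ≠ 0 := by
    obtain ⟨j, hj, hQj⟩ := hQ
    exact ⟨j, hj, hQj⟩
  set j₀ := Nat.find hex with hj₀def
  have hj₀ : j₀ < n ∧ Q j₀ ≠ 0 := Nat.find_spec hex
  have hmin : ∀ j < n, j < j₀ → Q j = 0 := by
    intro j hj hjj₀
    by_contra hQj
    exact Nat.find_min hex hjj₀ ⟨hj, hQj⟩
  set D := UnaryExpPoly.derivFamily (j₀ : K) Q with hDdef
  -- the derivative of `F E(-x)^{j₀}` is `G E(-x)^{j₀}`
  have hder : ∀ x, HasFieldDerivAt (fun y => UnaryExpPoly.eval E Q n y * E (-y) ^ j₀)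
      (UnaryExpPoly.eval E D n x * E (-x) ^ j₀) x :=
    fun x => hE.hasFieldDerivAt_unaryExpPoly_mul Q n j₀ x
  have hzerosF := hE.setOf_unaryExpPoly_mul_eq_zero Q n j₀
  have hzerosG := hE.setOf_unaryExpPoly_mul_eq_zero D n j₀
  by_cases hD : ∃ j < n, D j ≠ 0
  · -- inductive case: `G ≠ 0` has smaller budget
    have hbD : UnaryExpPoly.budget D n + 1 ≤ b :=
      hb ▸ UnaryExpPoly.budget_derivFamily_lt hj₀.1 hj₀.2
    obtain ⟨hfinG, hcardG⟩ := ih (UnaryExpPoly.budget D n) (by omega) D rfl hD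
    have hfinG' : {x | UnaryExpPoly.eval E D n x * E (-x) ^ j₀ = 0}.Finite := by
      rw [hzerosG]; exact hfinG
    obtain ⟨hfin, hcard⟩ := hDC.finite_setOf_eq_zero_of_deriv hlt hadd
      (f := fun y => UnaryExpPoly.eval E Q n y * E (-y) ^ j₀)
      (f' := fun y => UnaryExpPoly.eval E D n y * E (-y) ^ j₀)
      (UnaryExpPoly.definable_graph_eval_mul hadd hmul hEdef Q n j₀) hder hfinG'
    have hfin₂ : {x | UnaryExpPoly.eval E Q n x = 0}.Finite := by
      rw [← hzerosF]; exact hfin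
    have hcard₂ : {x | UnaryExpPoly.eval E Q n x = 0}.ncard ≤
        {x | UnaryExpPoly.eval E D n x = 0}.ncard + 1 := by
      rw [← hzerosF, ← hzerosG]; exact hcard
    refine ⟨hfin₂, hcard₂.trans ?_⟩
    have hbDpos : 0 < UnaryExpPoly.budget D n := by
      obtain ⟨j, hj, hDj⟩ := hD
      exact UnaryExpPoly.budget_pos hj hDj
    omega
  · -- base case: all derived coefficients vanish, so `F = c E^{j₀}` with `c ≠ 0`
    push Not at hD
    have hQj : ∀ j < n, j ≠ j₀ → Q j = 0 := by
      intro j hj hne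
      rcases lt_or_gt_of_ne hne with hlt' | hgt
      · exact hmin j hj hlt'
      · have hc : ((j : K) - (j₀ : K)) ≠ 0 := by
          rw [sub_ne_zero]
          exact_mod_cast hne
        exact UnaryExpPoly.eq_zero_of_derivative_add_C_mul hc (hD j hj)
    have hQj₀ : (Q j₀).natDegree = 0 := by
      refine UnaryExpPoly.natDegree_eq_zero_of_derivative_eq_zero' ?_
      rw [← UnaryExpPoly.derivFamily_self Q j₀]
      exact hD j₀ hj₀.1
    have hconst : Q j₀ = C ((Q j₀).coeff 0) := eq_C_of_natDegree_eq_zero hQj₀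
    have hc0 : (Q j₀).coeff 0 ≠ 0 := by
      intro h0
      apply hj₀.2
      rw [hconst, h0, C_0]
    have hempty : {x | UnaryExpPoly.eval E Q n x = 0} = ∅ := by
      ext x
      simp only [mem_setOf_eq, mem_empty_iff_false, iff_false]
      rw [UnaryExpPoly.eval_eq_single E hj₀.1 hQj x, hconst, eval_C]
      exact mul_ne_zero hc0 (pow_ne_zero _ (hE.pos x).ne')
    rw [hempty]
    exact ⟨finite_empty, by simp⟩

/-- **Corollary (finiteness)**: a one-variable exponential polynomial over `K` with a nonzero
coefficient has only finitely many zeros. [cite: FornasieroServi2010, Theorem 8.4] -/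
theorem setOf_unaryExpPoly_eq_zero_finite (hDC : L.IsDefinablyComplete K)
    (hlt : (univ : Set K).Definable L {v : Fin 2 → K | v 0 < v 1})
    (hadd : (univ : Set K).Definable L {v : Fin 3 → K | v 2 = v 0 + v 1})
    (hmul : (univ : Set K).Definable L {v : Fin 3 → K | v 2 = v 0 * v 1})
    (hEdef : (univ : Set K).Definable L {v : Fin 2 → K | v 1 = E (v 0)})
    (P : ℕ → K[X]) (n : ℕ) (hP : ∃ j < n, P j ≠ 0) :
    {x | ∑ j ∈ Finset.range n, (P j).eval x * E x ^ j = 0}.Finite :=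
  (hE.finite_setOf_unaryExpPoly_eq_zero hDC hlt hadd hmul hEdef P n hP).1

end IsOrderedExp

end OrderedExp

end Literature.ModelTheory.ExponentialFields
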